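import Summits.AtomisticToContinuum.HydrodynamicLimit.Theorems.LambertianContactSwapLambertianEulerStarShellsTools
import HarnessLib

/-!
# Disjoint velocity shells factorise under the free rung-0 product law
# (`LambertianContactSwap.LambertianEuler`, stmt-AtomisticToContinuum-11854, line `Sketch`; lead c10,
# piece W4 `DisjointShells`: registered stub `pi_disjointShells_le`)

Static estimate for lead c10's concentration theorem (the MATCHING TERM of the `k`-th moment of the
shell-pair count at equilibrium).  Under the FREE rung-0 law
`U_n := ⊗_{i < n} (Haar ⊗ N(w, ϑ id))` on `Config n (Fin 3) 𝕋³` (positions i.i.d. Haar on `𝕋³`,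
velocities i.i.d. Gaussian `gaussMeasure w ϑ`, all particles independent), the velocity SHELL of
width `δ` of the ordered pair `(a, b)` is the event `ε ≤ d(x_a, x_b) ≤ ε + δ ‖v_a − v_b‖`
(minimal-image distance, `Torus.norm_geometry_sepVec`).  For `k` ordered pairs `t l = (i_l, j_l)`,
`i_l ≠ j_l`, using `2k` DISTINCT particles (the two-element label sets `{i_l, j_l}` are pairwise
disjoint) and `0 ≤ δ ≤ ε ≤ 1/4`,

  `U_n {∀ l, ε ≤ d(x_{i_l}, x_{j_l}) ≤ ε + δ ‖v_{i_l} − v_{j_l}‖} ≤ (C ε² δ)^k`,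
  `C = C(w, ϑ) = (3 v₁ + 64) M₃²`, `M₃ = ∫ (1 + ‖v‖)³ dN(w, ϑ id)` (`pi_disjointShells_le`).

Proof.  The indicator of the event is dominated by (indeed equal to) the product over `l` of the
pair kernels `G(y_{i_l}, y_{j_l})`, `G(z, q) = 𝟙{ε ≤ d(z.1, q.1) ≤ ε + δ ‖z.2 − q.2‖}`.  An abstract
DISJOINT-PAIR FACTORISATION under a product of copies of a probability measure
(`lintegral_pi_prod_pairs_eq`: `∫⁻ Π_l H_l(y_{i_l}, y_{j_l}) d(⊗μ) = Π_l ∫⁻∫⁻ H_l dμ dμ`, by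
induction on `k`, peeling the last pair one coordinate at a time by Tonelli over `Measure.pi` —
`lmarginal_singleton`, `lintegral_eq_of_lmarginal_eq`, packaged as `lintegral_pi_peel_pair`)
reduces the bound to ONE pair, where the leaf integral `lintegral_leafShell_le` of
`…StarShellsTools` (shell section `volume_sepVec_shell_le`: `≤ (3v₁+64) ε² δ (1 + ‖v_a − v_b‖)³`,
then the Gaussian moment) gives `∫⁻∫⁻ G ≤ (3 v₁ + 64) ε² δ M₃ · M₃`.

References: Cercignani–Illner–Pulvirenti 1994 §2.2 (collision cylinders and shells);
Gallagher–Saint-Raymond–Texier 2013, Lemma 4.1.2.  All statements [folklore].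
-/

noncomputable section

namespace Summit.AtomisticToContinuum.HydrodynamicLimit.Theorems.LambertianContactSwapLambertianEulerDisjointShells

open scoped BigOperators Topology ENNReal InnerProductSpace
open MeasureTheory ProbabilityTheory Filter Set
open Literature.MathematicalPhysics.KineticTheory Literature.MathematicalPhysics.StatisticalMechanics
open Literature.Analysis.FluidPDE
open Summit.AtomisticToContinuum.HydrodynamicLimit.Theorems.LambertianContactSwapLambertianEulerStarShellsTools

/-! ## Abstract factorisation over disjoint pairs under `Measure.pi` -/

/-- **Peeling one pair of coordinates.**  Under a product of copies of a probability measure `μ`,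
if `P ≥ 0` is measurable and does not depend on the coordinates `a ≠ b`, and `G ≥ 0` is jointly
measurable, then `∫⁻ P(y) G(y a, y b) d(⊗μ)(y) = (∫⁻ P d(⊗μ)) · ∫⁻∫⁻ G(z, q) dμ(q) dμ(z)`
(Tonelli over the coordinate `b`, then over `a`: `lmarginal_singleton`,
`lintegral_eq_of_lmarginal_eq`). [folklore] -/
theorem lintegral_pi_peel_pair {ι α : Type*} [Fintype ι] [DecidableEq ι]
    [MeasurableSpace α] (μ : Measure α) [IsProbabilityMeasure μ] {a b : ι} (hab : a ≠ b)
    (P : (ι → α) → ℝ≥0∞) (hP : Measurable P)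
    (hPa : ∀ (y : ι → α) (z : α), P (Function.update y a z) = P y)
    (hPb : ∀ (y : ι → α) (q : α), P (Function.update y b q) = P y)
    (G : α → α → ℝ≥0∞) (hG : Measurable (Function.uncurry G)) :
    ∫⁻ y, P y * G (y a) (y b) ∂Measure.pi (fun _ : ι => μ) =
      (∫⁻ y, P y ∂Measure.pi (fun _ : ι => μ)) * ∫⁻ z, ∫⁻ q, G z q ∂μ ∂μ := by
  have hGy : Measurable fun y : ι → α => G (y a) (y b) := by
    have h : Measurable ((Function.uncurry G) ∘ fun y : ι → α => (y a, y b)) :=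
      hG.comp ((measurable_pi_apply a).prodMk (measurable_pi_apply b))
    exact h
  have hGa : Measurable fun z => ∫⁻ q, G z q ∂μ := hG.lintegral_prod_right
  have hf : Measurable fun y : ι → α => P y * G (y a) (y b) := hP.mul hGy
  have hf₁ : Measurable fun y : ι → α => P y * ∫⁻ q, G (y a) q ∂μ :=
    hP.mul (hGa.comp (measurable_pi_apply a))
  have hf₂ : Measurable fun y : ι → α => P y * ∫⁻ z, ∫⁻ q, G z q ∂μ ∂μ := hP.mul_const _
  -- integrating out the coordinate `b`
  have h1 : ∫⋯∫⁻_{b}, (fun y : ι → α => P y * G (y a) (y b)) ∂(fun _ : ι => μ) =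
      ∫⋯∫⁻_{b}, (fun y : ι → α => P y * ∫⁻ q, G (y a) q ∂μ) ∂(fun _ : ι => μ) := by
    rw [lmarginal_singleton, lmarginal_singleton]
    funext y
    simp only [hPb, Function.update_self, Function.update_of_ne hab]
    rw [lintegral_const_mul _ hG.of_uncurry_left, lintegral_const, measure_univ, mul_one]
  -- integrating out the coordinate `a`
  have h2 : ∫⋯∫⁻_{a}, (fun y : ι → α => P y * ∫⁻ q, G (y a) q ∂μ) ∂(fun _ : ι => μ) =
      ∫⋯∫⁻_{a}, (fun y : ι → α => P y * ∫⁻ z, ∫⁻ q, G z q ∂μ ∂μ) ∂(fun _ : ι => μ) := by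
    rw [lmarginal_singleton, lmarginal_singleton]
    funext y
    simp only [hPa, Function.update_self]
    rw [lintegral_const_mul _ hGa, lintegral_const, measure_univ, mul_one]
  rw [lintegral_eq_of_lmarginal_eq {b} hf hf₁ h1, lintegral_eq_of_lmarginal_eq {a} hf₁ hf₂ h2,
    lintegral_mul_const _ hP]

/-- **Disjoint-pair factorisation under a product of copies of a probability measure.**  For `k`
ordered pairs `t l = (i_l, j_l)` of labels with `i_l ≠ j_l` and pairwise disjoint label sets
`{i_l, j_l}`, and jointly measurable `H_l ≥ 0`:
`∫⁻ Π_l H_l(y i_l, y j_l) d(⊗ μ)(y) = Π_l ∫⁻∫⁻ H_l(z, q) dμ(q) dμ(z)`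
(induction on `k`, peeling the last pair by `lintegral_pi_peel_pair`; the base case is
`(⊗μ)(univ) = 1`). [folklore] -/
theorem lintegral_pi_prod_pairs_eq {ι α : Type*} [Fintype ι] [DecidableEq ι]
    [MeasurableSpace α] (μ : Measure α) [IsProbabilityMeasure μ] :
    ∀ (k : ℕ) (t : Fin k → ι × ι), (∀ l, (t l).1 ≠ (t l).2) →
      (∀ l l', l ≠ l' → Disjoint ({(t l).1, (t l).2} : Finset ι) {(t l').1, (t l').2}) →
      ∀ (H : Fin k → α → α → ℝ≥0∞), (∀ l, Measurable (Function.uncurry (H l))) →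
        ∫⁻ y, ∏ l, H l (y (t l).1) (y (t l).2) ∂Measure.pi (fun _ : ι => μ) =
          ∏ l, ∫⁻ z, ∫⁻ q, H l z q ∂μ ∂μ := by
  intro k
  induction k with
  | zero =>
      intro t _ _ H _
      simp only [Finset.univ_eq_empty, Finset.prod_empty, lintegral_const, measure_univ, mul_one]
  | succ k ih =>
      intro t ht hd H hH
      have hHy : ∀ (l : Fin (k + 1)) (i j : ι), Measurable fun y : ι → α => H l (y i) (y j) := by
        intro l i j
        have h : Measurable ((Function.uncurry (H l)) ∘ fun y : ι → α => (y i, y j)) :=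
          (hH l).comp ((measurable_pi_apply i).prodMk (measurable_pi_apply j))
        exact h
      -- the earlier pairs avoid the two labels of the last pair
      have hav : ∀ i : Fin k,
          ((t (Fin.castSucc i)).1 ≠ (t (Fin.last k)).1 ∧ (t (Fin.castSucc i)).1 ≠ (t (Fin.last k)).2) ∧
          ((t (Fin.castSucc i)).2 ≠ (t (Fin.last k)).1 ∧ (t (Fin.castSucc i)).2 ≠ (t (Fin.last k)).2) := by
        intro i
        have hdis := hd _ _ (Fin.castSucc_lt_last i).ne
        rw [Finset.disjoint_left] at hdis
        have h1 := hdis (Finset.mem_insert_self _ _)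
        have h2 := hdis (Finset.mem_insert_of_mem (Finset.mem_singleton_self _))
        simp only [Finset.mem_insert, Finset.mem_singleton, not_or] at h1 h2
        exact ⟨h1, h2⟩
      -- the product of the first `k` factors ignores the coordinates of the last pair
      have hP : Measurable fun y : ι → α =>
          ∏ i : Fin k, H (Fin.castSucc i) (y (t (Fin.castSucc i)).1) (y (t (Fin.castSucc i)).2) :=
        Finset.measurable_prod _ fun i _ => hHy _ _ _
      have hPa : ∀ (y : ι → α) (z : α),
          ∏ i : Fin k, H (Fin.castSucc i) (Function.update y (t (Fin.last k)).1 z (t (Fin.castSucc i)).1)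
              (Function.update y (t (Fin.last k)).1 z (t (Fin.castSucc i)).2) =
            ∏ i : Fin k, H (Fin.castSucc i) (y (t (Fin.castSucc i)).1) (y (t (Fin.castSucc i)).2) := by
        intro y z
        refine Finset.prod_congr rfl fun i _ => ?_
        rw [Function.update_of_ne (hav i).1.1, Function.update_of_ne (hav i).2.1]
      have hPb : ∀ (y : ι → α) (q : α),
          ∏ i : Fin k, H (Fin.castSucc i) (Function.update y (t (Fin.last k)).2 q (t (Fin.castSucc i)).1)
              (Function.update y (t (Fin.last k)).2 q (t (Fin.castSucc i)).2) =
            ∏ i : Fin k, H (Fin.castSucc i) (y (t (Fin.castSucc i)).1) (y (t (Fin.castSucc i)).2) := by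
        intro y q
        refine Finset.prod_congr rfl fun i _ => ?_
        rw [Function.update_of_ne (hav i).1.2, Function.update_of_ne (hav i).2.2]
      have step := lintegral_pi_peel_pair μ (ht (Fin.last k)) _ hP hPa hPb (H (Fin.last k)) (hH _)
      have hih := ih (fun i => t (Fin.castSucc i)) (fun i => ht _)
        (fun i j hij => hd _ _ fun h => hij (Fin.castSucc_injective _ h))
        (fun i => H (Fin.castSucc i)) fun i => hH _
      calc ∫⁻ y, ∏ l, H l (y (t l).1) (y (t l).2) ∂Measure.pi (fun _ : ι => μ)
          = ∫⁻ y, (∏ i : Fin k, H (Fin.castSucc i) (y (t (Fin.castSucc i)).1)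
              (y (t (Fin.castSucc i)).2)) * H (Fin.last k) (y (t (Fin.last k)).1) (y (t (Fin.last k)).2)
              ∂Measure.pi (fun _ : ι => μ) := by
            simp_rw [Fin.prod_univ_castSucc]
        _ = (∫⁻ y, ∏ i : Fin k, H (Fin.castSucc i) (y (t (Fin.castSucc i)).1)
              (y (t (Fin.castSucc i)).2) ∂Measure.pi (fun _ : ι => μ)) *
              ∫⁻ z, ∫⁻ q, H (Fin.last k) z q ∂μ ∂μ := step
        _ = ∏ l, ∫⁻ z, ∫⁻ q, H l z q ∂μ ∂μ := by
            rw [hih, Fin.prod_univ_castSucc]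

/-! ## The disjoint-shells estimate -/

/-- **`k` vertex-disjoint velocity shells under the free rung-0 product law** (registered stub
`pi_disjointShells_le` of lead c10).  For every drift `w` and temperature parameter `ϑ` there is
`C = C(w, ϑ) > 0` such that for all `n`, `0 < ε ≤ 1/4`, `0 ≤ δ ≤ ε`, every `k` and every `k` ordered
pairs `t l = (i_l, j_l)` in `Fin n` with `i_l ≠ j_l` and pairwise disjoint label sets `{i_l, j_l}`:
`U_n {∀ l, ε ≤ d(x_{i_l}, x_{j_l}) ≤ ε + δ ‖v_{i_l} − v_{j_l}‖} ≤ (C ε² δ)^k`,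
`U_n = ⊗_{i<n} (Haar ⊗ N(w, ϑ id))` (the event's indicator is at most the product of the `k` pair
kernels; the disjoint-pair factorisation `lintegral_pi_prod_pairs_eq`; each pair contributes
`≤ (3v₁+64) ε² δ M₃²` by the leaf integral `lintegral_leafShell_le` and the Gaussian moment of the
centre; `C = (3 v₁ + 64) M₃²`, `M₃ = ∫ (1 + ‖v‖)³ dN(w, ϑ id)`). [folklore] -/
theorem pi_disjointShells_le :
    ∀ (w : V3) (ϑ : ℝ), ∃ C : ℝ, 0 < C ∧ ∀ (n : ℕ) (ε δ : ℝ), 0 < ε → ε ≤ 1 / 4 → 0 ≤ δ → δ ≤ ε →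
      ∀ (k : ℕ) (t : Fin k → Fin n × Fin n), (∀ l, (t l).1 ≠ (t l).2) →
        (∀ l l', l ≠ l' → Disjoint ({(t l).1, (t l).2} : Finset (Fin n)) {(t l').1, (t l').2}) →
        Measure.pi (fun _ : Fin n => (volume : Measure T3).prod (gaussMeasure w ϑ))
          {y : Config n (Fin 3) T3 | ∀ l, ε ≤ ‖(Torus.geometry (Fin 3)).sepVec (y (t l).1).1 (y (t l).2).1‖ ∧
              ‖(Torus.geometry (Fin 3)).sepVec (y (t l).1).1 (y (t l).2).1‖ ≤ ε + δ * ‖(y (t l).1).2 - (y (t l).2).2‖} ≤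
          ENNReal.ofReal ((C * ε ^ 2 * δ) ^ k) := by
  intro w ϑ
  -- the constant: `K = 3 v₁ + 64` and the Gaussian moment `M = M₃`
  obtain ⟨M, hM⟩ : ∃ M : ℝ, ∫ v, (1 + ‖v‖) ^ (0 + 3) ∂gaussMeasure w ϑ = M := ⟨_, rfl⟩
  have hM1 : 1 ≤ M := hM ▸ one_le_integral_one_add_norm_pow w ϑ _
  have hv := v₁_pos
  have hM0 : 0 < M := by linarith
  refine ⟨(3 * v₁ + 64) * M * M, by positivity, ?_⟩
  intro n ε δ hε hε4 hδ hδε k t ht hd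
  -- the one-pair kernel: indicator of the shell of width `δ` about the centre `z`
  set G : T3 × V3 → T3 × V3 → ℝ≥0∞ := fun z q =>
    {q : T3 × V3 | ε ≤ ‖(Torus.geometry (Fin 3)).sepVec z.1 q.1‖ ∧
        ‖(Torus.geometry (Fin 3)).sepVec z.1 q.1‖ ≤ ε + δ * ‖z.2 - q.2‖}.indicator
      (fun q => ENNReal.ofReal ((1 + ‖q.2‖) ^ 0)) q with hG
  have hGm : Measurable (Function.uncurry G) := by
    have hd : Measurable fun p : (T3 × V3) × (T3 × V3) =>
        ‖(Torus.geometry (Fin 3)).sepVec p.1.1 p.2.1‖ :=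
      (Torus.measurable_geometry_sepVec.comp
        ((measurable_fst.comp measurable_fst).prodMk (measurable_fst.comp measurable_snd))).norm
    have hr : Measurable fun p : (T3 × V3) × (T3 × V3) => ε + δ * ‖p.1.2 - p.2.2‖ :=
      measurable_const.add (((measurable_snd.comp measurable_fst).sub
        (measurable_snd.comp measurable_snd)).norm.const_mul _)
    have hS : MeasurableSet {p : (T3 × V3) × (T3 × V3) |
        ε ≤ ‖(Torus.geometry (Fin 3)).sepVec p.1.1 p.2.1‖ ∧
          ‖(Torus.geometry (Fin 3)).sepVec p.1.1 p.2.1‖ ≤ ε + δ * ‖p.1.2 - p.2.2‖} :=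
      (measurableSet_le measurable_const hd).inter (measurableSet_le hd hr)
    have hh : Measurable fun p : (T3 × V3) × (T3 × V3) => ENNReal.ofReal ((1 + ‖p.2.2‖) ^ 0) :=
      ENNReal.measurable_ofReal.comp
        ((measurable_const.add (measurable_snd.comp measurable_snd).norm).pow_const 0)
    have heq : Function.uncurry G =
        {p : (T3 × V3) × (T3 × V3) | ε ≤ ‖(Torus.geometry (Fin 3)).sepVec p.1.1 p.2.1‖ ∧
          ‖(Torus.geometry (Fin 3)).sepVec p.1.1 p.2.1‖ ≤ ε + δ * ‖p.1.2 - p.2.2‖}.indicator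
          fun p => ENNReal.ofReal ((1 + ‖p.2.2‖) ^ 0) := by
      funext p
      simp only [hG, Function.uncurry, Set.indicator_apply, mem_setOf_eq]
    rw [heq]
    exact hh.indicator hS
  -- the event is measurable
  have hdm : ∀ i j : Fin n, Measurable fun y : Config n (Fin 3) T3 =>
      ‖(Torus.geometry (Fin 3)).sepVec (y i).1 (y j).1‖ := fun i j =>
    (Torus.measurable_geometry_sepVec.comp
      ((measurable_pi_apply i).fst.prodMk (measurable_pi_apply j).fst)).norm
  have hrm : ∀ i j : Fin n, Measurable fun y : Config n (Fin 3) T3 => ε + δ * ‖(y i).2 - (y j).2‖ :=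
    fun i j => measurable_const.add
      (((measurable_pi_apply i).snd.sub (measurable_pi_apply j).snd).norm.const_mul δ)
  have hEm : MeasurableSet {y : Config n (Fin 3) T3 |
      ∀ l, ε ≤ ‖(Torus.geometry (Fin 3)).sepVec (y (t l).1).1 (y (t l).2).1‖ ∧
        ‖(Torus.geometry (Fin 3)).sepVec (y (t l).1).1 (y (t l).2).1‖ ≤
          ε + δ * ‖(y (t l).1).2 - (y (t l).2).2‖} := by
    rw [Set.setOf_forall]
    exact MeasurableSet.iInter fun l =>
      (measurableSet_le measurable_const (hdm _ _)).inter (measurableSet_le (hdm _ _) (hrm _ _))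
  -- pointwise: the indicator of the event is at most the product of the pair kernels
  have hpt : ∀ y : Config n (Fin 3) T3,
      {y : Config n (Fin 3) T3 |
        ∀ l, ε ≤ ‖(Torus.geometry (Fin 3)).sepVec (y (t l).1).1 (y (t l).2).1‖ ∧
          ‖(Torus.geometry (Fin 3)).sepVec (y (t l).1).1 (y (t l).2).1‖ ≤
            ε + δ * ‖(y (t l).1).2 - (y (t l).2).2‖}.indicator 1 y ≤
      ∏ l, G (y (t l).1) (y (t l).2) := by
    intro y
    by_cases hy : y ∈ {y : Config n (Fin 3) T3 |
        ∀ l, ε ≤ ‖(Torus.geometry (Fin 3)).sepVec (y (t l).1).1 (y (t l).2).1‖ ∧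
          ‖(Torus.geometry (Fin 3)).sepVec (y (t l).1).1 (y (t l).2).1‖ ≤
            ε + δ * ‖(y (t l).1).2 - (y (t l).2).2‖}
    · rw [Set.indicator_of_mem hy, Pi.one_apply]
      have hy' := hy
      simp only [mem_setOf_eq] at hy'
      have hGl : ∀ l, G (y (t l).1) (y (t l).2) = 1 := by
        intro l
        simp only [hG]
        rw [Set.indicator_of_mem, pow_zero, ENNReal.ofReal_one]
        exact hy' l
      rw [Finset.prod_eq_one fun l _ => hGl l]
    · rw [Set.indicator_of_notMem hy]
      exact zero_le
  -- one pair: the leaf integral and the Gaussian moment of the centre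
  have hleaf : ∀ z : T3 × V3,
      ∫⁻ q, G z q ∂(volume : Measure T3).prod (gaussMeasure w ϑ) ≤
        ENNReal.ofReal ((3 * v₁ + 64) * ε ^ 2 * δ * (1 + ‖z.2‖) ^ 3 * M) := by
    intro z
    rw [← hM]
    simp only [hG]
    exact lintegral_leafShell_le w ϑ 0 hε hε4 hδ hδε z
  have hmz : Measurable fun z : T3 × V3 => ENNReal.ofReal ((1 + ‖z.2‖) ^ (0 + 3)) :=
    ENNReal.measurable_ofReal.comp ((measurable_const.add measurable_snd.norm).pow_const _)
  have hmv : Measurable fun v : V3 => ENNReal.ofReal ((1 + ‖v‖) ^ (0 + 3)) :=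
    ENNReal.measurable_ofReal.comp ((measurable_const.add measurable_norm).pow_const _)
  have hc : 0 ≤ (3 * v₁ + 64) * ε ^ 2 * δ * M := by positivity
  have hpair : ∫⁻ z, ∫⁻ q, G z q ∂(volume : Measure T3).prod (gaussMeasure w ϑ)
      ∂(volume : Measure T3).prod (gaussMeasure w ϑ) ≤
      ENNReal.ofReal ((3 * v₁ + 64) * M * M * ε ^ 2 * δ) := by
    calc ∫⁻ z, ∫⁻ q, G z q ∂(volume : Measure T3).prod (gaussMeasure w ϑ)
          ∂(volume : Measure T3).prod (gaussMeasure w ϑ)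
        ≤ ∫⁻ z, ENNReal.ofReal ((3 * v₁ + 64) * ε ^ 2 * δ * (1 + ‖z.2‖) ^ 3 * M)
            ∂(volume : Measure T3).prod (gaussMeasure w ϑ) := lintegral_mono hleaf
      _ = ∫⁻ z, ENNReal.ofReal ((3 * v₁ + 64) * ε ^ 2 * δ * M) *
            ENNReal.ofReal ((1 + ‖z.2‖) ^ (0 + 3)) ∂(volume : Measure T3).prod (gaussMeasure w ϑ) := by
          refine lintegral_congr fun z => ?_
          rw [← ENNReal.ofReal_mul hc]
          congr 1
          ring
      _ = ENNReal.ofReal ((3 * v₁ + 64) * ε ^ 2 * δ * M) *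
            ∫⁻ v, ENNReal.ofReal ((1 + ‖v‖) ^ (0 + 3)) ∂gaussMeasure w ϑ := by
          rw [lintegral_const_mul _ hmz,
            (measurePreserving_snd (μ := (volume : Measure T3)) (ν := gaussMeasure w ϑ)).lintegral_comp
              hmv]
      _ = ENNReal.ofReal ((3 * v₁ + 64) * M * M * ε ^ 2 * δ) := by
          rw [lintegral_one_add_norm_pow, hM, ← ENNReal.ofReal_mul hc]
          congr 1
          ring
  have hC : 0 ≤ (3 * v₁ + 64) * M * M * ε ^ 2 * δ := by positivity
  calc Measure.pi (fun _ : Fin n => (volume : Measure T3).prod (gaussMeasure w ϑ))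
        {y : Config n (Fin 3) T3 |
          ∀ l, ε ≤ ‖(Torus.geometry (Fin 3)).sepVec (y (t l).1).1 (y (t l).2).1‖ ∧
            ‖(Torus.geometry (Fin 3)).sepVec (y (t l).1).1 (y (t l).2).1‖ ≤
              ε + δ * ‖(y (t l).1).2 - (y (t l).2).2‖}
      = ∫⁻ y, {y : Config n (Fin 3) T3 |
          ∀ l, ε ≤ ‖(Torus.geometry (Fin 3)).sepVec (y (t l).1).1 (y (t l).2).1‖ ∧
            ‖(Torus.geometry (Fin 3)).sepVec (y (t l).1).1 (y (t l).2).1‖ ≤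
              ε + δ * ‖(y (t l).1).2 - (y (t l).2).2‖}.indicator 1 y
          ∂Measure.pi (fun _ : Fin n => (volume : Measure T3).prod (gaussMeasure w ϑ)) :=
        (lintegral_indicator_one hEm).symm
    _ ≤ ∫⁻ y, ∏ l, G (y (t l).1) (y (t l).2)
          ∂Measure.pi (fun _ : Fin n => (volume : Measure T3).prod (gaussMeasure w ϑ)) :=
        lintegral_mono hpt
    _ = ∏ _l : Fin k, ∫⁻ z, ∫⁻ q, G z q ∂(volume : Measure T3).prod (gaussMeasure w ϑ)
          ∂(volume : Measure T3).prod (gaussMeasure w ϑ) :=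
        lintegral_pi_prod_pairs_eq _ k t ht hd (fun _ => G) fun _ => hGm
    _ ≤ ∏ _l : Fin k, ENNReal.ofReal ((3 * v₁ + 64) * M * M * ε ^ 2 * δ) :=
        Finset.prod_le_prod' fun _ _ => hpair
    _ = ENNReal.ofReal (((3 * v₁ + 64) * M * M * ε ^ 2 * δ) ^ k) := by
        rw [Finset.prod_const, Finset.card_univ, Fintype.card_fin, ENNReal.ofReal_pow hC]

end Summit.AtomisticToContinuum.HydrodynamicLimit.Theorems.LambertianContactSwapLambertianEulerDisjointShells

end
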